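/-
Copyright (c) 2026 the pub-hodgecm-mathlib formalisation cell (harness21).  Prover seat hodgecm-mathlib-K2Liu-p13 (g2), Track B «K2-LIT»,
#184♮ = hLiu418 = `stmt-HodgeConjecture-24832`; Road I v3 organ U1-CT-ind STAGE 2 (Q2), file F4-2a (LEAD F0P6-plan (g14) 10:39:33Z «F4-2 → F4 → F5 → D-U1 stage 3 =»;
CENSUS-Q2-F4 `K2/K2Liu-p13/g2/CENSUS-Q2-F4-KlingenUnfold.K2Liu-p13-g2.md` (D1)(D2)).
-/
import Summits.HodgeConjecture.HodgeConjecture.Theorems.K2LiuConstantTermBigCellUnfold   -- ★ O41.4 (b): `apply_out_mk_mul`; transitively ★ D9, ★ `countable_ratH`, ★ covering weights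
import Literature.MeasureTheory.Group.CoveringWeightsBochner
import HarnessLib

/-!
# Crux `HLiu418`, Road I v3, organ U1 stage 2 (Q2), file F4-2a: PERIODS OF THE SIEGEL EISENSTEIN SERIES ALONG AN ARBITRARY SUBGROUP `N ≤ H(𝔸)` —
# Fubini for series under (H), constant classes, and the split `∫ β • E(u h) dν = (∫ β) • Σ'_{q ∈ C} f(γ_q h) + Σ'_{q ∉ C} ∫ β • f(γ_q u h) dν`

Cell `hodgecm-mathlib`, crux item hLiu418 = `stmt-HodgeConjecture-24832`; squad K2 ∕ K2Liu; LEAD F0P6-plan (g14), co-dealer K2E5-plan (g7); prover K2Liu-p13 (g2).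
THEOREMS ONLY (no `def`, no instance, no notation, no named-fact hypothesis, no `sorry`); lane `--supports stmt-HodgeConjecture-24832 --as helper` (count-neutral).

WHY.  ★ O41.4 `K2LiuConstantTermDelta.constTerm_three_cells` unfolds the constant term of `E^Δ(·; f) = Σ'_{q ∈ P_Δ(L⁺)\H(L⁺)} f(γ_q ·)` along the SIEGEL unipotent
`N_Δ(𝔸) = ↥unipDelta`; the Q-constant term of organ U1 stage 2 (file F4 `K2LiuKlingenConstantTermUnfold`) is the same computation along the KLINGEN unipotent
`N_Q(𝔸) = ↥(klingenUnipA Ψ)` (★ F4-1).  The first two steps of that computation do not see which subgroup is used, so they are typed here ONCE for an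
arbitrary subgroup `Nsub ≤ H(𝔸)` carrying a caller-supplied Borel structure, a measure `νN` and a weight `β : ↥Nsub → [0,∞]` (a covering weight for some
countable group acting on `↥Nsub` — only `β ≤ 1` is used): with `γ_q = Quotient.out q` and the analytic binder
  (H)  `∫⁻ (Σ'_q ‖f(γ_q u h)‖ₑ) β(u) dνN(u) ≠ ∞`,
* §1 bookkeeping on `↥Nsub` (`P_Δ(L⁺)\H(L⁺)` is countable — ★ `countable_ratH`, inlined as in ★ O41.4): the lattice `(ratH).subgroupOf Nsub = Nsub ∩ H(L⁺)` is countable, measurability of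
  the translates `u ↦ f(a (u h))` and of the weighted summands, `‖β(u) • z‖ₑ = ‖z‖ₑ β(u)`;
* §2 **`integral_wt_smul_eisensteinSeriesDelta_eq_tsum`** — (H) ⇒ `∫ β(u) • E(u h; f) dνN = Σ'_q ∫ β(u) • f(γ_q u h) dνN`, the series of integrals being
  absolutely summable (`summable_integral_wt_smul_apply_out`, `tsum_lintegral_enorm_wt_smul_apply_out_ne_top`) — Fubini for series (Mathlib `integral_tsum`);
* §3 **`integral_wt_smul_apply_eq_smul_of_forall_eq`** — a class whose integrand is constant in `u` contributes `(∫ β dνN) • f(γ_q h)`;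
* §4 **`integral_wt_smul_eisensteinSeriesDelta_eq_add_tsum_compl`** — for ANY set `C` of classes with `Nsub`-constant integrand:
  `∫ β(u) • E(u h; f) dνN = (∫ β dνN) • Σ'_{q ∈ C} f(γ_q h) + Σ'_{q ∈ Cᶜ} ∫ β(u) • f(γ_q u h) dνN` (under (H)), with the summability of both pieces.
For `Nsub := klingenUnipA Ψ` and `C :=` the identity cell `{⟦Ψ(q)⟧ : q ∈ Q(L⁺)}` (★ F4-1c, constancy ★ F4-1f) this is the two-cell form of the Q-constant term (file F4);
the classes of `Cᶜ` are then regrouped into `N(L⁺)`-orbits by file F4-2b `K2LiuSiegelQuotSubgroupOrbitUnfold`.  `f` need only be CONTINUOUS in §2–§4 (no section property).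
[MoeglinWaldspurger1995, II.1.7], [GelbartPiatetskishapiroRallis1987, Part A §2], [KudlaRallis1994, §2], [Garrett2018, §3.10], [CogdellAnalyticTheory2004, §2.3].
HONEST LABEL.  Count-neutral helper: `HC_CM` is proved only modulo the 7 printed citations (2 remaining named inputs: hLiu418 = `stmt-HodgeConjecture-24832`,
h413 = `stmt-HodgeConjecture-24833`) until rung 0 closes.
-/

set_option autoImplicit false
set_option linter.dupNamespace false -- the mandated namespace repeats `HodgeConjecture.HodgeConjecture`

noncomputable section

open scoped Matrix ENNReal NNReal
open NumberField IsDedekindDomain MeasureTheory MeasureTheory.Measure Filter Set Function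
open Literature.NumberTheory.Automorphic Literature.NumberTheory.GaloisRepresentations
open Literature.NumberTheory.GelbartRogawski1991 Literature.NumberTheory.GelbartRogawski1991.GRConstruction
open Literature.NumberTheory.K2Lit.SiegelDoubled Literature.MeasureTheory.Group

namespace Summit.HodgeConjecture.HodgeConjecture.Cruxes.HLiu418.K2LiuSiegelEisensteinSubgroupPeriodCells

open K2LiuSiegelDoubledUnfold K2LiuConstantTermBigCellUnfold

variable {L : Type} [Field L] [NumberField L] [IsCMField L]
variable {N M n : ℕ} {e : Fin N × Fin M ≃ Fin n}
  {dV : Fin N → L} {hdV : ∀ i, IsCMField.complexConj L (dV i) = dV i}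
  {dW : Fin M → L} {hdW : ∀ i, IsCMField.complexConj L (dW i) = dW i}
variable {Nsub : Subgroup (HA L e dV hdV dW hdW)}

/-! ## §1 Bookkeeping on an arbitrary subgroup `Nsub ≤ H(𝔸)` -/

variable (Nsub) in
/-- **the lattice `N(L⁺) := Nsub ∩ H(L⁺)` (★ `Subgroup.subgroupOf`) of an arbitrary subgroup `Nsub ≤ H(𝔸)` is countable** (it embeds in the countable `H(L⁺)`);
for `Nsub := unipDelta` this is ★ `countable_unipDeltaRat`. [cite: Garrett2018, §1.8] [cite: MoeglinWaldspurger1995, I.2.1] -/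
theorem countable_subgroupOf_ratH : Countable ((ratH L e dV hdV dW hdW).subgroupOf Nsub) := by
  haveI : Countable (ratH L e dV hdV dW hdW) := countable_ratH L e dV hdV dW hdW
  have hinj : Function.Injective (fun γ : (ratH L e dV hdV dW hdW).subgroupOf Nsub =>
      (⟨((γ : Nsub) : HA L e dV hdV dW hdW), Subgroup.mem_subgroupOf.1 γ.2⟩ : ratH L e dV hdV dW hdW)) := by
    intro γ γ' hγ
    have h' := congrArg (fun r : ratH L e dV hdV dW hdW => (r : HA L e dV hdV dW hdW)) hγ
    exact Subtype.ext (Subtype.ext h')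
  exact hinj.countable

/-- elements of the lattice `N(L⁺)` are rational: `((γ : Nsub) : H(𝔸)) ∈ H(L⁺)`. [cite: MoeglinWaldspurger1995, I.2.1] -/
theorem coe_mem_ratH_of_mem_subgroupOf {γ : Nsub} (hγ : γ ∈ (ratH L e dV hdV dW hdW).subgroupOf Nsub) :
    ((γ : Nsub) : HA L e dV hdV dW hdW) ∈ ratH L e dV hdV dW hdW :=
  Subgroup.mem_subgroupOf.1 hγ

/-- elements of the lattice `N(L⁺)`, as a subtype, are rational. [cite: MoeglinWaldspurger1995, I.2.1] -/
theorem coe_coe_mem_ratH (γ : (ratH L e dV hdV dW hdW).subgroupOf Nsub) :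
    (((γ : Nsub)) : HA L e dV hdV dW hdW) ∈ ratH L e dV hdV dW hdW :=
  Subgroup.mem_subgroupOf.1 γ.2

section Measurable

variable [MeasurableSpace Nsub] [BorelSpace Nsub]

/-- the translate `u ↦ f(a · u · h)` of a continuous `f` along `↥Nsub` is (Borel) measurable in `‖·‖ₑ`. [folklore] -/
theorem measurable_enorm_apply_mul_coe_mul_subgroup {f : HA L e dV hdV dW hdW → ℂ} (hfc : Continuous f) (a h : HA L e dV hdV dW hdW) :
    Measurable (fun u : Nsub => ‖f (a * (u : HA L e dV hdV dW hdW) * h)‖ₑ) :=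
  (hfc.comp ((continuous_const.mul continuous_subtype_val).mul continuous_const)).measurable.enorm

/-- the same for the association `f(a · (u · h))` used by ★ `eisensteinSeriesDelta f (u h)`. [folklore] -/
theorem measurable_enorm_apply_mul_coe_mul_subgroup' {f : HA L e dV hdV dW hdW → ℂ} (hfc : Continuous f) (a h : HA L e dV hdV dW hdW) :
    Measurable (fun u : Nsub => ‖f (a * ((u : HA L e dV hdV dW hdW) * h))‖ₑ) :=
  (hfc.comp (continuous_const.mul (continuous_subtype_val.mul continuous_const))).measurable.enorm

/-- the weighted summand `u ↦ β(u) • f(a (u h))` is a.e.-strongly measurable (`β` measurable, `f` continuous). [folklore] -/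
theorem aestronglyMeasurable_wt_smul_apply_subgroup (νN : Measure Nsub) {β : Nsub → ℝ≥0∞} (hβm : Measurable β)
    {f : HA L e dV hdV dW hdW → ℂ} (hfc : Continuous f) (a h : HA L e dV hdV dW hdW) :
    AEStronglyMeasurable (fun u : Nsub => (β u).toReal • f (a * ((u : HA L e dV hdV dW hdW) * h))) νN :=
  (hβm.ennreal_toReal.smul (hfc.comp (continuous_const.mul (continuous_subtype_val.mul continuous_const))).measurable).aestronglyMeasurable

end Measurable

/-- `‖β(u) • z‖ₑ = ‖z‖ₑ · β(u)` for a weight with `β ≤ 1` (every covering weight, ★ `IsCoveringWeight.le_one`). [folklore] -/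
theorem enorm_wt_smul_of_le_one {X : Type*} {β : X → ℝ≥0∞} (hβ1 : ∀ x, β x ≤ 1) (u : X) (z : ℂ) : ‖(β u).toReal • z‖ₑ = ‖z‖ₑ * β u := by
  have hfin : β u ≠ ∞ := ne_top_of_le_ne_top ENNReal.one_ne_top (hβ1 u)
  rw [enorm_smul, Real.enorm_eq_ofReal ENNReal.toReal_nonneg, ENNReal.ofReal_toReal hfin, mul_comm]

/-- `‖β(u) • z‖ₑ = ‖z‖ₑ · β(u)` for a covering weight of any countable group action on `↥Nsub`. [folklore] -/
theorem enorm_wt_smul_subgroup [MeasurableSpace Nsub] {Γ : Type*} [Group Γ] [MulAction Γ Nsub] {β : Nsub → ℝ≥0∞} (hβ : IsCoveringWeight Γ β)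
    (u : Nsub) (z : ℂ) : ‖(β u).toReal • z‖ₑ = ‖z‖ₑ * β u :=
  enorm_wt_smul_of_le_one hβ.le_one u z

/-! ## §2 Fubini for series under (H): `∫ β • E(·h) dνN = Σ'_q ∫ β • f(γ_q · h) dνN` -/

section Fubini

variable [MeasurableSpace Nsub] [BorelSpace Nsub]

/-- **the `L¹` sizes of the weighted summands sum to the (H)-integral**: `Σ'_q ∫⁻ ‖β(u) • f(γ_q u h)‖ₑ dνN = ∫⁻ (Σ'_q ‖f(γ_q u h)‖ₑ) β dνN` (Tonelli for series).
[cite: MoeglinWaldspurger1995, II.1.7] -/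
theorem tsum_lintegral_enorm_wt_smul_apply_out_eq (νN : Measure Nsub) {β : Nsub → ℝ≥0∞} (hβm : Measurable β) (hβ1 : ∀ u, β u ≤ 1)
    {f : HA L e dV hdV dW hdW → ℂ} (hfc : Continuous f) (h : HA L e dV hdV dW hdW) :
    ∑' q : SiegelDeltaQuot L e dV hdV dW hdW, ∫⁻ u, ‖(β u).toReal •
        f ((((Quotient.out q : ratH L e dV hdV dW hdW) : HA L e dV hdV dW hdW)) * ((u : HA L e dV hdV dW hdW) * h))‖ₑ ∂νN =
      ∫⁻ u, (∑' q : SiegelDeltaQuot L e dV hdV dW hdW,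
        ‖f ((((Quotient.out q : ratH L e dV hdV dW hdW) : HA L e dV hdV dW hdW)) * ((u : HA L e dV hdV dW hdW) * h))‖ₑ) * β u ∂νN := by
  haveI : Countable (ratH L e dV hdV dW hdW) := countable_ratH L e dV hdV dW hdW
  haveI : Countable (SiegelDeltaQuot L e dV hdV dW hdW) := by unfold SiegelDeltaQuot; exact inferInstance
  simp_rw [enorm_wt_smul_of_le_one hβ1]
  rw [← lintegral_tsum (f := fun (q : SiegelDeltaQuot L e dV hdV dW hdW) (u : Nsub) =>
      ‖f ((((Quotient.out q : ratH L e dV hdV dW hdW) : HA L e dV hdV dW hdW)) * ((u : HA L e dV hdV dW hdW) * h))‖ₑ * β u)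
    fun q => ((measurable_enorm_apply_mul_coe_mul_subgroup' hfc _ h).mul hβm).aemeasurable]
  simp_rw [ENNReal.tsum_mul_right]

/-- **(H) ⇒ the series of `L¹` sizes is finite**: `Σ'_q ∫⁻ ‖β(u) • f(γ_q u h)‖ₑ dνN ≠ ∞`. [cite: MoeglinWaldspurger1995, II.1.7] -/
theorem tsum_lintegral_enorm_wt_smul_apply_out_ne_top (νN : Measure Nsub) {β : Nsub → ℝ≥0∞} (hβm : Measurable β) (hβ1 : ∀ u, β u ≤ 1)
    {f : HA L e dV hdV dW hdW → ℂ} (hfc : Continuous f) (h : HA L e dV hdV dW hdW)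
    (hH : ∫⁻ u, (∑' q : SiegelDeltaQuot L e dV hdV dW hdW,
        ‖f ((((Quotient.out q : ratH L e dV hdV dW hdW) : HA L e dV hdV dW hdW)) * ((u : HA L e dV hdV dW hdW) * h))‖ₑ) * β u ∂νN ≠ ∞) :
    ∑' q : SiegelDeltaQuot L e dV hdV dW hdW, ∫⁻ u, ‖(β u).toReal •
        f ((((Quotient.out q : ratH L e dV hdV dW hdW) : HA L e dV hdV dW hdW)) * ((u : HA L e dV hdV dW hdW) * h))‖ₑ ∂νN ≠ ∞ := by
  rw [tsum_lintegral_enorm_wt_smul_apply_out_eq νN hβm hβ1 hfc h]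
  exact hH

/-- **(H) ⇒ the series of integrals `q ↦ ∫ β(u) • f(γ_q u h) dνN` is (absolutely) summable.** [cite: MoeglinWaldspurger1995, II.1.7] [cite: Garrett2018, §3.10] -/
theorem summable_integral_wt_smul_apply_out (νN : Measure Nsub) {β : Nsub → ℝ≥0∞} (hβm : Measurable β) (hβ1 : ∀ u, β u ≤ 1)
    {f : HA L e dV hdV dW hdW → ℂ} (hfc : Continuous f) (h : HA L e dV hdV dW hdW)
    (hH : ∫⁻ u, (∑' q : SiegelDeltaQuot L e dV hdV dW hdW,
        ‖f ((((Quotient.out q : ratH L e dV hdV dW hdW) : HA L e dV hdV dW hdW)) * ((u : HA L e dV hdV dW hdW) * h))‖ₑ) * β u ∂νN ≠ ∞) :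
    Summable fun q : SiegelDeltaQuot L e dV hdV dW hdW =>
      ∫ u, (β u).toReal • f ((((Quotient.out q : ratH L e dV hdV dW hdW) : HA L e dV hdV dW hdW)) * ((u : HA L e dV hdV dW hdW) * h)) ∂νN := by
  have hsum := tsum_lintegral_enorm_wt_smul_apply_out_ne_top νN hβm hβ1 hfc h hH
  refine Summable.of_norm_bounded (ENNReal.summable_toReal hsum) fun q => ?_
  rw [← toReal_enorm]
  exact ENNReal.toReal_mono (ENNReal.ne_top_of_tsum_ne_top hsum q) (enorm_integral_le_lintegral_enorm _)

/-- **FUBINI FOR SERIES UNDER (H)**: for a continuous `f`, a measure `νN` on `↥Nsub`, a measurable weight `β ≤ 1` and `h ∈ H(𝔸)`,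
  `∫ β(u) • E^Δ(u h; f) dνN(u) = Σ'_{q ∈ P_Δ(L⁺)\H(L⁺)} ∫ β(u) • f(γ_q u h) dνN(u)`
(Mathlib `integral_tsum`; the hypothesis (H) is the integrability of the majorant series over one weighted fundamental domain).
[cite: MoeglinWaldspurger1995, II.1.7] [cite: Garrett2018, §3.10] [cite: CogdellAnalyticTheory2004, §2.3] -/
theorem integral_wt_smul_eisensteinSeriesDelta_eq_tsum (νN : Measure Nsub) {β : Nsub → ℝ≥0∞} (hβm : Measurable β) (hβ1 : ∀ u, β u ≤ 1)
    {f : HA L e dV hdV dW hdW → ℂ} (hfc : Continuous f) (h : HA L e dV hdV dW hdW)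
    (hH : ∫⁻ u, (∑' q : SiegelDeltaQuot L e dV hdV dW hdW,
        ‖f ((((Quotient.out q : ratH L e dV hdV dW hdW) : HA L e dV hdV dW hdW)) * ((u : HA L e dV hdV dW hdW) * h))‖ₑ) * β u ∂νN ≠ ∞) :
    ∫ u, (β u).toReal • eisensteinSeriesDelta L e dV hdV dW hdW f ((u : HA L e dV hdV dW hdW) * h) ∂νN =
      ∑' q : SiegelDeltaQuot L e dV hdV dW hdW,
        ∫ u, (β u).toReal • f ((((Quotient.out q : ratH L e dV hdV dW hdW) : HA L e dV hdV dW hdW)) * ((u : HA L e dV hdV dW hdW) * h)) ∂νN := by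
  haveI : Countable (ratH L e dV hdV dW hdW) := countable_ratH L e dV hdV dW hdW
  haveI : Countable (SiegelDeltaQuot L e dV hdV dW hdW) := by unfold SiegelDeltaQuot; exact inferInstance
  rw [← integral_tsum (fun q => aestronglyMeasurable_wt_smul_apply_subgroup νN hβm hfc _ h)
    (tsum_lintegral_enorm_wt_smul_apply_out_ne_top νN hβm hβ1 hfc h hH)]
  refine integral_congr_ae (ae_of_all _ fun u => ?_)
  show (β u).toReal • eisensteinSeriesDelta L e dV hdV dW hdW f ((u : HA L e dV hdV dW hdW) * h) = ∑' q, (β u).toReal • _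
  rw [tsum_const_smul'' (β u).toReal]
  rfl

end Fubini

/-! ## §3 Constant classes: `∫ β(u) • f(a u h) dνN = (∫ β dνN) • f(a h)` -/

/-- **A CLASS WHOSE INTEGRAND IS CONSTANT IN `u` CONTRIBUTES `vol_β · f(a h)`**: if `f(a · u · h) = f(a · h)` for all `u ∈ Nsub` then
`∫ β(u) • f(a (u h)) dνN = (∫ β dνN) • f(a h)` (for `Nsub := unipDelta` and `a = γ_{[1]}` this is ★ O41.4's identity cell; for `Nsub := klingenUnipA Ψ` and
`a = γ_{⟦Ψ q⟧}`, `q ∈ Q(L⁺)`, it is every class of the identity cell of the Q-constant term, ★ F4-1f). [cite: MoeglinWaldspurger1995, II.1.7] -/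
theorem integral_wt_smul_apply_eq_smul_of_forall_eq [MeasurableSpace Nsub] (νN : Measure Nsub) (β : Nsub → ℝ≥0∞)
    (f : HA L e dV hdV dW hdW → ℂ) (a h : HA L e dV hdV dW hdW) (hconst : ∀ u : Nsub, f (a * ((u : HA L e dV hdV dW hdW) * h)) = f (a * h)) :
    ∫ u, (β u).toReal • f (a * ((u : HA L e dV hdV dW hdW) * h)) ∂νN = (∫ u, (β u).toReal ∂νN) • f (a * h) := by
  simp_rw [hconst]
  exact integral_smul_const _ _

/-! ## §4 The split along a set `C` of constant classes -/

section Split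

variable [MeasurableSpace Nsub] [BorelSpace Nsub]

/-- **SPLITTING THE PERIOD ALONG A SET OF CONSTANT CLASSES.**  `f` continuous, `νN` a measure on `↥Nsub`, `β ≤ 1` a measurable weight, `h ∈ H(𝔸)`, (H), and a set
`C ⊆ P_Δ(L⁺)\H(L⁺)` such that `f(γ_q u h) = f(γ_q h)` for `q ∈ C`, `u ∈ Nsub`.  THEN
  `∫ β(u) • E^Δ(u h; f) dνN(u) = (∫ β dνN) • Σ'_{q ∈ C} f(γ_q h) + Σ'_{q ∈ Cᶜ} ∫ β(u) • f(γ_q u h) dνN(u)`.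
For the KLINGEN unipotent and `C =` the identity cell `{⟦Ψ(q)⟧ : q ∈ Q(L⁺)}` this is the two-cell form of the Q-constant term of the Siegel Eisenstein series on `U(2,2)`
(file F4); the `Cᶜ`-classes are regrouped into `N(L⁺)`-orbits by file F4-2b. [cite: MoeglinWaldspurger1995, II.1.7] [cite: GelbartPiatetskishapiroRallis1987, Part A §2]
[cite: KudlaRallis1994, §2] -/
theorem integral_wt_smul_eisensteinSeriesDelta_eq_add_tsum_compl (νN : Measure Nsub) {β : Nsub → ℝ≥0∞} (hβm : Measurable β) (hβ1 : ∀ u, β u ≤ 1)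
    {f : HA L e dV hdV dW hdW → ℂ} (hfc : Continuous f) (h : HA L e dV hdV dW hdW)
    (hH : ∫⁻ u, (∑' q : SiegelDeltaQuot L e dV hdV dW hdW,
        ‖f ((((Quotient.out q : ratH L e dV hdV dW hdW) : HA L e dV hdV dW hdW)) * ((u : HA L e dV hdV dW hdW) * h))‖ₑ) * β u ∂νN ≠ ∞)
    (C : Set (SiegelDeltaQuot L e dV hdV dW hdW))
    (hC : ∀ q ∈ C, ∀ u : Nsub, f ((((Quotient.out q : ratH L e dV hdV dW hdW) : HA L e dV hdV dW hdW)) * ((u : HA L e dV hdV dW hdW) * h)) =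
      f ((((Quotient.out q : ratH L e dV hdV dW hdW) : HA L e dV hdV dW hdW)) * h)) :
    ∫ u, (β u).toReal • eisensteinSeriesDelta L e dV hdV dW hdW f ((u : HA L e dV hdV dW hdW) * h) ∂νN =
      (∫ u, (β u).toReal ∂νN) • (∑' q : C, f ((((Quotient.out (q : SiegelDeltaQuot L e dV hdV dW hdW) : ratH L e dV hdV dW hdW) :
          HA L e dV hdV dW hdW)) * h)) +
        ∑' q : ↥(Cᶜ), ∫ u, (β u).toReal • f ((((Quotient.out (q : SiegelDeltaQuot L e dV hdV dW hdW) : ratH L e dV hdV dW hdW) :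
          HA L e dV hdV dW hdW)) * ((u : HA L e dV hdV dW hdW) * h)) ∂νN := by
  set J : SiegelDeltaQuot L e dV hdV dW hdW → ℂ := fun q =>
    ∫ u, (β u).toReal • f ((((Quotient.out q : ratH L e dV hdV dW hdW) : HA L e dV hdV dW hdW)) * ((u : HA L e dV hdV dW hdW) * h)) ∂νN with hJ
  have hJs : Summable J := summable_integral_wt_smul_apply_out νN hβm hβ1 hfc h hH
  rw [integral_wt_smul_eisensteinSeriesDelta_eq_tsum νN hβm hβ1 hfc h hH,
    show (∑' q : SiegelDeltaQuot L e dV hdV dW hdW,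
        ∫ u, (β u).toReal • f ((((Quotient.out q : ratH L e dV hdV dW hdW) : HA L e dV hdV dW hdW)) * ((u : HA L e dV hdV dW hdW) * h)) ∂νN) = ∑' q, J q
      from rfl,
    ← (hJs.subtype C).tsum_add_tsum_compl (hJs.subtype (Cᶜ : Set (SiegelDeltaQuot L e dV hdV dW hdW)))]
  have hC' : ∀ q : C, J q = (∫ u, (β u).toReal ∂νN) •
      f ((((Quotient.out (q : SiegelDeltaQuot L e dV hdV dW hdW) : ratH L e dV hdV dW hdW) : HA L e dV hdV dW hdW)) * h) := fun q =>
    integral_wt_smul_apply_eq_smul_of_forall_eq νN β f _ h (hC q q.2)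
  have h1 : (∑' q : C, J q) = (∫ u, (β u).toReal ∂νN) •
      ∑' q : C, f ((((Quotient.out (q : SiegelDeltaQuot L e dV hdV dW hdW) : ratH L e dV hdV dW hdW) : HA L e dV hdV dW hdW)) * h) := by
    rw [← tsum_const_smul'' (∫ u, (β u).toReal ∂νN)]
    exact tsum_congr hC'
  rw [show (∑' q : C, J ((q : C) : SiegelDeltaQuot L e dV hdV dW hdW)) = ∑' q : C, J q from rfl, h1]

/-- **… and the `Cᶜ`-piece is absolutely summable** (for regrouping it further). [cite: MoeglinWaldspurger1995, II.1.7] -/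
theorem summable_integral_wt_smul_apply_out_subtype (νN : Measure Nsub) {β : Nsub → ℝ≥0∞} (hβm : Measurable β) (hβ1 : ∀ u, β u ≤ 1)
    {f : HA L e dV hdV dW hdW → ℂ} (hfc : Continuous f) (h : HA L e dV hdV dW hdW)
    (hH : ∫⁻ u, (∑' q : SiegelDeltaQuot L e dV hdV dW hdW,
        ‖f ((((Quotient.out q : ratH L e dV hdV dW hdW) : HA L e dV hdV dW hdW)) * ((u : HA L e dV hdV dW hdW) * h))‖ₑ) * β u ∂νN ≠ ∞)
    (S : Set (SiegelDeltaQuot L e dV hdV dW hdW)) :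
    Summable fun q : S => ∫ u, (β u).toReal • f ((((Quotient.out (q : SiegelDeltaQuot L e dV hdV dW hdW) : ratH L e dV hdV dW hdW) :
      HA L e dV hdV dW hdW)) * ((u : HA L e dV hdV dW hdW) * h)) ∂νN :=
  (summable_integral_wt_smul_apply_out νN hβm hβ1 hfc h hH).subtype S

omit [BorelSpace Nsub] in
/-- **the (H)-binder restricts to any set of classes**: `∫⁻ (Σ'_{q ∈ S} ‖f(γ_q u h)‖ₑ) β dνN ≤ ∫⁻ (Σ'_q ‖f(γ_q u h)‖ₑ) β dνN`, so it is `≠ ∞` under (H) — the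
orbit pieces of (H) consumed by file F4-2b. [cite: MoeglinWaldspurger1995, II.1.7] -/
theorem lintegral_tsum_subtype_enorm_mul_ne_top (νN : Measure Nsub) (β : Nsub → ℝ≥0∞) (f : HA L e dV hdV dW hdW → ℂ) (h : HA L e dV hdV dW hdW)
    (hH : ∫⁻ u, (∑' q : SiegelDeltaQuot L e dV hdV dW hdW,
        ‖f ((((Quotient.out q : ratH L e dV hdV dW hdW) : HA L e dV hdV dW hdW)) * ((u : HA L e dV hdV dW hdW) * h))‖ₑ) * β u ∂νN ≠ ∞)
    (S : Set (SiegelDeltaQuot L e dV hdV dW hdW)) :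
    ∫⁻ u, (∑' q : S, ‖f ((((Quotient.out (q : SiegelDeltaQuot L e dV hdV dW hdW) : ratH L e dV hdV dW hdW) : HA L e dV hdV dW hdW)) *
      ((u : HA L e dV hdV dW hdW) * h))‖ₑ) * β u ∂νN ≠ ∞ := by
  refine ne_top_of_le_ne_top hH (lintegral_mono fun u => ?_)
  exact mul_le_mul' (ENNReal.tsum_comp_le_tsum_of_injective Subtype.val_injective _) le_rfl

end Split

end Summit.HodgeConjecture.HodgeConjecture.Cruxes.HLiu418.K2LiuSiegelEisensteinSubgroupPeriodCells

end
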